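import Literature.NumberTheory.GaloisRepresentations.DeligneSerreBoundedSubgroups
import Literature.NumberTheory.GaloisRepresentations.DeligneSerreGL2SubgroupsProofs
import HarnessLib

/-!
# Deligne–Serre 1974, Prop. 7.2 (`DeligneSerreBoundedSubgroups`) — discharged from the tree theorem

Topic `NumberTheory/GaloisRepresentations`; theorems only (no definitions, no named facts).

The named fact `Literature.NumberTheory.GaloisRepresentations.DeligneSerre1974_prop72_card_le_of_condC`
(`DeligneSerreBoundedSubgroups.lean`, typed 2026-08-16 for route `Langlands/BianchiDeligneSerre`, step (iv)
of `DeligneSerreTransportK`) is P. Deligne, J.-P. Serre, *Formes modulaires de poids 1*, Ann. Sci. ÉNS (4) 7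
(1974), **Prop. 7.2** (p. 524): for `η < 1/2` and `M ≥ 0` there is `A = A(η, M)` such that every
semisimple `G ≤ GL₂(𝐅_ℓ)` with `C(η, M)` has `|G| ≤ A`.  The SAME proposition was typed two days earlier as
`Literature.NumberTheory.GaloisRepresentations.DeligneSerre1974.prop72` (`DeligneSerreGL2Subgroups.lean`)
and PROVED there and then (`DeligneSerre1974.prop72_holds`, file `DeligneSerreGL2SubgroupsProofs.lean`:
the printed case analysis (a) `G ⊇ SL₂(𝐅_ℓ)`, (b) `G` in a Cartan subgroup, (c) `G` in the normaliser of
a Cartan subgroup, (d) image `𝔄₄/𝔖₄/𝔄₅`, pp. 524–525, with the orbit count of Serre 1972 §2.5 in place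
of Dickson's list).  The two transcriptions differ only in vocabulary:

* "la représentation identique est semi-simple": `DeligneSerre.IsSemisimpleSubgroup G` =
  `IsSemisimpleModule 𝐅_ℓ[G] (natRep G).asModule` versus `DeligneSerre1974.IsSemisimpleSubgroup G` =
  `Representation.IsSemisimpleRepresentation (glStdRepresentation ∘ G.subtype)`; both representations
  are `g ↦ (v ↦ g *ᵥ v)` (`DeligneSerre.natRep_eq_subgroupRepresentation`) and Mathlib's
  `Representation.isSemisimpleRepresentation_iff_isSemisimpleModule_asModule` identifies the two notions
  (`DeligneSerre.isSemisimpleSubgroup_iff`);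
* `C(η, M)`: `DeligneSerre.CondC` counts characteristic polynomials `det(T − h)` over a `Finset.image`,
  `DeligneSerre1974.HasPropertyC` counts the printed `det(1 − hT) = Matrix.charpolyRev h` as the
  `Set.ncard` of an image; since `charpolyRev h = (charpoly h).reverse` (`Matrix.reverse_charpoly`) the
  first count bounds the second for the same subset `H` (`DeligneSerre.card_image_charpolyRev_le`,
  `DeligneSerre.hasPropertyC_of_condC`);
* `0 < η` versus `0 ≤ η`.

Hence `DeligneSerre1974_prop72_card_le_of_condC_holds` (net debt −1).  A separate leaf module (rather than
an append to the statement file, which imports all of Mathlib and carries the definitions) so that the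
statement file stays definition-only.

## References

* P. Deligne, J.-P. Serre, *Formes modulaires de poids 1*, Ann. Sci. École Norm. Sup. (4) 7 (1974),
  507–530, §7.1 and Prop. 7.2 with its proof (pp. 524–525) [DeligneSerre1974] (read 2026-08-27,
  `lit read paper:doi-10-24033-asens-1277`, p. 19 of the materialised text).
-/

noncomputable section

namespace Literature.NumberTheory.GaloisRepresentations

namespace DeligneSerre

variable {ℓ : ℕ} [Fact ℓ.Prime]

/-- The two renderings of "la représentation identique `G → GL₂(𝐅_ℓ)`" agree:
`natRep G g v = g *ᵥ v = DeligneSerre1974.subgroupRepresentation G g v`.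
[cite: DeligneSerre1974, §7.1] -/
theorem natRep_eq_subgroupRepresentation (G : Subgroup (GL (Fin 2) (ZMod ℓ))) :
    natRep G = DeligneSerre1974.subgroupRepresentation G := by
  refine MonoidHom.ext fun g ↦ LinearMap.ext fun v ↦ ?_
  rw [DeligneSerre1974.subgroupRepresentation, MonoidHom.comp_apply, glStdRepresentation_apply]
  change ((Matrix.GeneralLinearGroup.toLin ((g : GL (Fin 2) (ZMod ℓ))) :
      (Fin 2 → ZMod ℓ) →ₗ[ZMod ℓ] Fin 2 → ZMod ℓ) : (Fin 2 → ZMod ℓ) → Fin 2 → ZMod ℓ) v = _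
  rw [Matrix.GeneralLinearGroup.toLin_apply, Matrix.mulVecLin_apply]
  rfl

/-- The two renderings of "`G` est semi-simple" (§7.1) agree: the natural representation is a
semisimple `𝐅_ℓ[G]`-module iff every subrepresentation of `𝐅_ℓ²` has a `G`-stable complement
(Mathlib `Representation.isSemisimpleRepresentation_iff_isSemisimpleModule_asModule`).
[cite: DeligneSerre1974, §7.1] -/
theorem isSemisimpleSubgroup_iff (G : Subgroup (GL (Fin 2) (ZMod ℓ))) :
    IsSemisimpleSubgroup G ↔ DeligneSerre1974.IsSemisimpleSubgroup G := by
  unfold IsSemisimpleSubgroup DeligneSerre1974.IsSemisimpleSubgroup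
  rw [natRep_eq_subgroupRepresentation,
    Representation.isSemisimpleRepresentation_iff_isSemisimpleModule_asModule]

/-- For a finite set `H` of invertible `2 × 2` matrices, the polynomials `det(1 − hT)`, `h ∈ H`
(`Matrix.charpolyRev`), are at most as numerous as the characteristic polynomials `det(T − h)`
(`Matrix.charpolyRev h = (Matrix.charpoly h).reverse`, `Matrix.reverse_charpoly`).
[cite: DeligneSerre1974, §7.1 condition C(η, M)] -/
theorem card_image_charpolyRev_le (H : Finset (GL (Fin 2) (ZMod ℓ))) :
    (H.image fun h : GL (Fin 2) (ZMod ℓ) ↦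
        Matrix.charpolyRev ((h : GL (Fin 2) (ZMod ℓ)) : Matrix (Fin 2) (Fin 2) (ZMod ℓ))).card ≤
      (H.image fun h : GL (Fin 2) (ZMod ℓ) ↦
        Matrix.charpoly ((h : GL (Fin 2) (ZMod ℓ)) : Matrix (Fin 2) (Fin 2) (ZMod ℓ))).card := by
  have hcomp : (fun h : GL (Fin 2) (ZMod ℓ) ↦
        Matrix.charpolyRev ((h : GL (Fin 2) (ZMod ℓ)) : Matrix (Fin 2) (Fin 2) (ZMod ℓ))) =
      Polynomial.reverse ∘ fun h : GL (Fin 2) (ZMod ℓ) ↦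
        Matrix.charpoly ((h : GL (Fin 2) (ZMod ℓ)) : Matrix (Fin 2) (Fin 2) (ZMod ℓ)) := by
    funext h
    exact (Matrix.reverse_charpoly _).symm
  rw [hcomp, ← Finset.image_image]
  exact Finset.card_image_le

/-- `C(η, M)` with characteristic polynomials (`CondC`) implies `C(η, M)` with the printed
`det(1 − hT)` (`DeligneSerre1974.HasPropertyC`), for the same subset `H`.
[cite: DeligneSerre1974, §7.1 condition C(η, M)] -/
theorem hasPropertyC_of_condC {G : Subgroup (GL (Fin 2) (ZMod ℓ))} {η : ℝ} {M : ℕ}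
    (h : CondC G η M) : DeligneSerre1974.HasPropertyC G η M := by
  obtain ⟨H, hHG, hcard, hM⟩ := h
  refine ⟨H, hHG, hcard, le_trans ?_ (le_trans (card_image_charpolyRev_le H) hM)⟩
  rw [← Finset.coe_image, Set.ncard_coe_finset]

end DeligneSerre

/-- **Deligne–Serre 1974, Proposition 7.2 — discharged**: the named fact
`DeligneSerre1974_prop72_card_le_of_condC` holds, by the tree theorem `DeligneSerre1974.prop72_holds`
(`DeligneSerreGL2SubgroupsProofs.lean`, the printed proof) transported along
`DeligneSerre.isSemisimpleSubgroup_iff` and `DeligneSerre.hasPropertyC_of_condC` (`0 < η` gives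
`0 ≤ η`).  The discharge has no binders: it is exactly `theorem X_holds : X`.
[cite: DeligneSerre1974, Prop. 7.2 (p. 524)] -/
theorem DeligneSerre1974_prop72_card_le_of_condC_holds : DeligneSerre1974_prop72_card_le_of_condC := by
  intro η hη0 hη M
  obtain ⟨A, hA⟩ := DeligneSerre1974.prop72_holds η M hη0.le hη
  refine ⟨A, fun ℓ _ G hss hC ↦ ?_⟩
  exact hA ℓ G ((DeligneSerre.isSemisimpleSubgroup_iff G).mp hss)
    (DeligneSerre.hasPropertyC_of_condC hC)

end Literature.NumberTheory.GaloisRepresentations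

end
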